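import Summits.CriticalPhenomena.PercolationContinuityZ3.Theorems.PercThresholdOneFragileWeavingGiantExistsSymmetry
import Summits.CriticalPhenomena.PercolationContinuityZ3.Theses.PercThresholdOne

/-!
# `FragileWeavingGiantExists` (stmt-CriticalPhenomena-5266) — density, fragility and the theorem

Part of the proof of support item `FragileWeavingGiantExists` of route `PercThresholdOne` by the stationary
hierarchical spanning tree of `ℤ³` (see `PercThresholdOneFragileWeavingGiantExistsDefs.lean` for the construction and the overview).
-/

noncomputable section

namespace Summit.CriticalPhenomena.PercolationContinuityZ3.Theorems.FragileGiant

open MeasureTheory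
open scoped ENNReal
open Literature.Probability.Percolation Literature.Probability.LatticeModels
open Literature.Probability.Percolation.DCT16

/-- **Density**: the witness percolates at the origin almost surely, in particular with positive
probability. -/
theorem νsym_real_percolates_pos : 0 < νsym.real {ξ : Set (Sym2 V3) | (openCluster ξ 0).Infinite} := by
  haveI := isProbabilityMeasure_νsym
  have hae : ∀ᵐ ξ ∂νsym, (openCluster ξ (0 : V3)).Infinite := by
    refine ae_νsym_of_forall (measurableSet_percolatesAt_holds (0 : V3)) fun ω hω g => ?_
    have : openCluster (relab (spEquiv g) (treeConfig ω)) 0 = Set.univ := by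
      refine Set.eq_univ_of_forall fun y => ?_
      show (openGraph (relab (spEquiv g) (treeConfig ω))).Reachable 0 y
      rw [reachable_relab_iff]; exact reachable_treeConfig ω hω _ _
    rw [this]; exact Set.infinite_univ
  have h1 : νsym {ξ : Set (Sym2 V3) | (openCluster ξ 0).Infinite} = 1 := by
    show νsym (percolatesAt 0) = 1
    rw [← prob_compl_eq_zero_iff (measurableSet_percolatesAt_holds (0 : V3))]
    rw [ae_iff] at hae
    exact hae
  rw [measureReal_def, h1, ENNReal.toReal_one]
  exact one_pos

/-- Intersection of the two coordinates is measurable on pairs of configurations. -/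
theorem measurable_inter_pair : Measurable fun π : Set (Sym2 V3) × Set (Sym2 V3) => π.1 ∩ π.2 :=
  measurable_set_iff.2 fun e => ((measurable_set_mem e).comp measurable_fst).and
    ((measurable_set_mem e).comp measurable_snd)

/-- The thinned one-arm event is measurable. -/
theorem measurableSet_thinEvent (n : ℕ) : MeasurableSet (thinEvent n) :=
  (measurableSet_siteToBoundary 3 n).preimage measurable_inter_pair

/-- Signed permutations preserve the inner boundary of boxes. -/
theorem spEquiv_mem_innerBoundary_iff (g : SP) (n : ℕ) (x : V3) :
    spEquiv g x ∈ innerBoundary (zdGraph 3) (box 3 n) ↔ x ∈ innerBoundary (zdGraph 3) (box 3 n) := by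
  simp only [mem_innerBoundary_iff, spEquiv, signedPerm_mem_box_iff]
  refine and_congr_right fun _ => ⟨?_, ?_⟩
  · rintro ⟨y, hy, hadj⟩
    obtain ⟨y', rfl⟩ := (Site.signedPerm g.1 g.2).surjective y
    rw [signedPerm_mem_box_iff] at hy
    exact ⟨y', hy, (zdSignedPermIso g.1 g.2).map_adj_iff.1 hadj⟩
  · rintro ⟨y, hy, hadj⟩
    exact ⟨Site.signedPerm g.1 g.2 y, by rwa [signedPerm_mem_box_iff], zdGraph_adj_signedPerm g.1 g.2 hadj⟩

/-- **Invariance of the one-arm event** under signed permutations. -/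
theorem relab_mem_siteToBoundary_iff (g : SP) (ζ : Set (Sym2 V3)) (n : ℕ) :
    relab (spEquiv g) ζ ∈ siteToBoundary 3 n ↔ ζ ∈ siteToBoundary 3 n := by
  rw [mem_siteToBoundary_iff, mem_siteToBoundary_iff]
  have hbox : spEquiv g '' (↑(box 3 n) : Set V3) = ↑(box 3 n) := signedPerm_image_box g.1 g.2 n
  have h0 : spEquiv g 0 = 0 := Site.signedPerm_zero g.1 g.2
  constructor
  · rintro ⟨y, hy, hpath⟩
    rw [pathIn_relab_iff, hbox, h0] at hpath
    exact ⟨spEquiv g y, (spEquiv_mem_innerBoundary_iff g n y).2 hy, hpath⟩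
  · rintro ⟨y, hy, hpath⟩
    refine ⟨(spEquiv g).symm y, ?_, ?_⟩
    · rw [← spEquiv_mem_innerBoundary_iff g, Equiv.apply_symm_apply]; exact hy
    · rw [pathIn_relab_iff, hbox, h0, Equiv.apply_symm_apply]; exact hpath

/-- `P_q` is invariant under the inverse relabelling of a signed permutation. -/
theorem bondPercolation_map_relab_symm (g : SP) (q : unitInterval) :
    (bondPercolation (zdGraph 3) q).map (relab (spEquiv g).symm) = bondPercolation (zdGraph 3) q := by
  have : (relab ((spEquiv g).symm : V3 → V3)) =
      ⇑(BondConfig.relabel (sym2Equiv (zdSignedPermIso g.1 g.2).toEquiv)) := by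
    funext ξ
    rw [relab_eq_relabel, Equiv.symm_symm]; rfl
  rw [this]
  exact bondPercolation_map_relabel_iso _ q

/-- **Transfer of the thinned one-arm probability** to the unrelabelled tree. -/
theorem thinned_prob_relab (g : SP) (ξ : Set (Sym2 V3)) (q : unitInterval) (n : ℕ) :
    bondPercolation (zdGraph 3) q {η | relab (spEquiv g) ξ ∩ η ∈ siteToBoundary 3 n} =
      bondPercolation (zdGraph 3) q {η | ξ ∩ η ∈ siteToBoundary 3 n} := by
  have hset : {η | relab (spEquiv g) ξ ∩ η ∈ siteToBoundary 3 n} =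
      relab (spEquiv g).symm ⁻¹' {ζ | ξ ∩ ζ ∈ siteToBoundary 3 n} := by
    ext η
    simp only [Set.mem_setOf_eq, Set.mem_preimage]
    conv_lhs => rw [← relab_relab_symm (spEquiv g) η, ← relab_inter, relab_mem_siteToBoundary_iff]
  have hmeas : MeasurableSet {ζ : Set (Sym2 V3) | ξ ∩ ζ ∈ siteToBoundary 3 n} :=
    (measurableSet_siteToBoundary 3 n).preimage (measurable_inter_pair.comp (measurable_const.prodMk measurable_id))
  rw [hset, ← Measure.map_apply (measurable_relab _) hmeas, bondPercolation_map_relab_symm]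

/-- **The polynomial-times-exponential bound for the witness.** -/
theorem prod_real_thinEvent_le (q : unitInterval) (n : ℕ) :
    (νsym.prod (bondPercolation (zdGraph 3) q)).real (thinEvent n) ≤ 6 * (2 * n + 1) ^ 2 * (q : ℝ) ^ ((n + 1) / 2) := by
  haveI := isProbabilityMeasure_νsym
  set B : ℝ := 6 * (2 * n + 1) ^ 2 * (q : ℝ) ^ ((n + 1) / 2) with hB
  have hB0 : 0 ≤ B := by have := q.2.1; positivity
  set Pq := bondPercolation (zdGraph 3) q with hPq
  have hE := measurableSet_thinEvent n
  have hf : Measurable fun ξ : Set (Sym2 V3) => Pq (Prod.mk ξ ⁻¹' thinEvent n) :=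
    measurable_measure_prodMk_left hE
  have hbound : ∀ g : SP, ∫⁻ ω, Pq (Prod.mk (relab (spEquiv g) (treeConfig ω)) ⁻¹' thinEvent n) ∂μ ≤ ENNReal.ofReal B := by
    intro g
    calc ∫⁻ ω, Pq (Prod.mk (relab (spEquiv g) (treeConfig ω)) ⁻¹' thinEvent n) ∂μ
        ≤ ∫⁻ _ω, ENNReal.ofReal B ∂μ := by
          refine lintegral_mono_ae ?_
          filter_upwards [ae_mem_goodSet] with ω hω
          have hpre : Prod.mk (relab (spEquiv g) (treeConfig ω)) ⁻¹' thinEvent n =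
              {η | relab (spEquiv g) (treeConfig ω) ∩ η ∈ siteToBoundary 3 n} := rfl
          rw [hpre, thinned_prob_relab]
          have hr := real_thinned_siteToBoundary_le ω hω q n
          rw [measureReal_def] at hr
          exact (ENNReal.le_ofReal_iff_toReal_le (measure_ne_top _ _) hB0).2 hr
      _ = ENNReal.ofReal B := by rw [lintegral_const, measure_univ, mul_one]
  have hmain : (νsym.prod Pq) (thinEvent n) ≤ ENNReal.ofReal B := by
    rw [Measure.prod_apply hE, νsym, lintegral_smul_measure, lintegral_finsetSum_measure]
    calc (Fintype.card SP : ℝ≥0∞)⁻¹ • ∑ g : SP, ∫⁻ ξ, Pq (Prod.mk ξ ⁻¹' thinEvent n) ∂(ν0.map (relab (spEquiv g)))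
        ≤ (Fintype.card SP : ℝ≥0∞)⁻¹ • ∑ _g : SP, ENNReal.ofReal B := by
          gcongr with g
          rw [ν0, Measure.map_map (measurable_relab _) measurable_treeConfig,
            lintegral_map hf ((measurable_relab _).comp measurable_treeConfig)]
          exact hbound g
      _ = ENNReal.ofReal B := by
          rw [Finset.sum_const, Finset.card_univ, nsmul_eq_mul, smul_eq_mul, ← mul_assoc,
            ENNReal.inv_mul_cancel (by simp) (ENNReal.natCast_ne_top _), one_mul]
  exact ENNReal.toReal_le_of_le_ofReal hB0 hmain

/-- For `n ≥ 1` a thinned arm needs an open edge at the origin. -/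
theorem exists_open_edge_of_mem_siteToBoundary {ξ η : Set (Sym2 V3)} (hξ : ξ ⊆ (zdGraph 3).edgeSet) {n : ℕ}
    (hn : 1 ≤ n) (h : ξ ∩ η ∈ siteToBoundary 3 n) : ∃ u ∈ (zdGraph 3).neighborFinset 0, s((0 : V3), u) ∈ η := by
  rw [mem_siteToBoundary_iff] at h
  obtain ⟨y, hy, hpath⟩ := h
  have hy0 : y ≠ 0 := by
    intro h0
    have := notMem_box_of_mem_innerBoundary_box (Nat.lt_of_lt_of_le Nat.zero_lt_one hn) hy
    rw [h0] at this
    exact this (zero_mem_box 3 0)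
  have key := pathIn_induction (fun z => z = 0 ∨ ∃ u ∈ (zdGraph 3).neighborFinset 0, s((0 : V3), u) ∈ η)
    hpath (Or.inl rfl) ?_
  · exact key.resolve_left hy0
  · rintro a b - - (rfl | h) hab
    · right
      rw [openGraph_adj] at hab
      refine ⟨b, ?_, hab.1.2⟩
      rw [SimpleGraph.mem_neighborFinset]
      exact (SimpleGraph.mem_edgeSet _).1 (hξ hab.1.1)
    · exact Or.inr h

/-- **The first step**: for `n ≥ 1` the thinned one-arm probability is at most `1 - (1 - q)^6`. -/
theorem prod_real_thinEvent_le_of_pos (q : unitInterval) {n : ℕ} (hn : 1 ≤ n) :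
    (νsym.prod (bondPercolation (zdGraph 3) q)).real (thinEvent n) ≤ 1 - (1 - (q : ℝ)) ^ 6 := by
  classical
  haveI := isProbabilityMeasure_νsym
  set Pq := bondPercolation (zdGraph 3) q
  set K : Finset (Sym2 V3) := ((zdGraph 3).neighborFinset 0).image fun u => s((0 : V3), u) with hK
  set A : Set (Set (Sym2 V3)) := {ξ | ¬ξ ⊆ (zdGraph 3).edgeSet}
  set Bset : Set (Set (Sym2 V3)) := {η | ∀ e ∈ K, e ∉ η}ᶜ
  have hsub : thinEvent n ⊆ A ×ˢ Set.univ ∪ Set.univ ×ˢ Bset := by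
    intro π hπ
    by_cases hξ : π.1 ⊆ (zdGraph 3).edgeSet
    · right
      refine ⟨Set.mem_univ _, ?_⟩
      obtain ⟨u, hu, hmem⟩ := exists_open_edge_of_mem_siteToBoundary hξ hn hπ
      simp only [Bset, Set.mem_compl_iff, Set.mem_setOf_eq, not_forall, not_not, exists_prop]
      exact ⟨_, Finset.mem_image.2 ⟨u, hu, rfl⟩, hmem⟩
    · left; exact ⟨hξ, Set.mem_univ _⟩
  have hA : νsym A = 0 := by
    have := ae_goodConfigs
    rw [ae_iff] at this
    refine measure_mono_null (fun ξ hξ => ?_) this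
    exact fun h => hξ h.1
  have hBmeas : MeasurableSet Bset := (measurableSet_forall_notMem K).compl
  calc (νsym.prod Pq).real (thinEvent n)
      ≤ (νsym.prod Pq).real (A ×ˢ Set.univ ∪ Set.univ ×ˢ Bset) := measureReal_mono hsub (measure_ne_top _ _)
    _ ≤ (νsym.prod Pq).real (A ×ˢ (Set.univ : Set (Set (Sym2 V3)))) + (νsym.prod Pq).real (Set.univ ×ˢ Bset) :=
        measureReal_union_le _ _
    _ = Pq.real Bset := by
        rw [measureReal_prod_prod, measureReal_prod_prod, measureReal_def νsym A, hA]
        simp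
    _ ≤ 1 - (1 - (q : ℝ)) ^ 6 := by
        rw [measureReal_compl (measurableSet_forall_notMem K), probReal_univ]
        have hge := le_bondPercolation_real_forall_notMem (zdGraph 3) q K
        have hcard : K.card ≤ 6 := by
          refine (Finset.card_image_le).trans ?_
          rw [card_neighborFinset_zdGraph_holds]
        have h1q : 0 ≤ 1 - (q : ℝ) := sub_nonneg.2 q.2.2
        have h1q' : 1 - (q : ℝ) ≤ 1 := by linarith [q.2.1]
        have : (1 - (q : ℝ)) ^ 6 ≤ (1 - (q : ℝ)) ^ K.card := pow_le_pow_of_le_one h1q h1q' hcard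
        linarith

/-- **Elementary exponential decay lemma**: a sequence in `[0, 1]` bounded by `θ < 1` from `n = 1` on
and by `C (n+1)² rⁿ` with `0 ≤ r < 1` decays exponentially. -/
theorem exists_exp_decay (P : ℕ → ℝ) (hP1 : ∀ n, P n ≤ 1) {θ : ℝ} (hθ : θ < 1)
    (hPθ : ∀ n, 1 ≤ n → P n ≤ θ) {r C : ℝ} (hr0 : 0 ≤ r) (hr1 : r < 1)
    (hPC : ∀ n, P n ≤ C * (n + 1) ^ 2 * r ^ n) : ∃ c : ℝ, 0 < c ∧ ∀ n : ℕ, P n ≤ Real.exp (-c * n) := by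
  -- geometric envelope
  set ρ : ℝ := (r + 1) / 2 with hρ
  have hρ0 : 0 < ρ := by rw [hρ]; linarith
  have hρ1 : ρ < 1 := by rw [hρ]; linarith
  have hrρ0 : 0 ≤ r / ρ := div_nonneg hr0 hρ0.le
  have hrρ1 : r / ρ < 1 := by rw [div_lt_one hρ0, hρ]; linarith
  set C' := max C 0 with hC'
  have hC'0 : 0 ≤ C' := le_max_right _ _
  have htend : Filter.Tendsto (fun n : ℕ => 4 * C' * ((n : ℝ) ^ 2 * (r / ρ) ^ n)) Filter.atTop (nhds 0) := by
    have := (tendsto_pow_const_mul_const_pow_of_lt_one 2 hrρ0 hrρ1).const_mul (4 * C')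
    rwa [mul_zero] at this
  obtain ⟨N, hN⟩ := Filter.eventually_atTop.1
    ((htend.eventually (gt_mem_nhds one_pos)).and (Filter.eventually_ge_atTop 1))
  -- large `n`
  have hlarge : ∀ n, N ≤ n → P n ≤ Real.exp (Real.log ρ * n) := by
    intro n hn
    obtain ⟨hlt, hn1⟩ := hN n hn
    have hn1' : (1 : ℝ) ≤ n := by exact_mod_cast hn1
    rw [← Real.rpow_def_of_pos hρ0, Real.rpow_natCast]
    calc P n ≤ C * (n + 1) ^ 2 * r ^ n := hPC n
      _ ≤ C' * (n + 1) ^ 2 * r ^ n := by gcongr; exact le_max_left _ _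
      _ ≤ C' * (4 * n ^ 2) * r ^ n := by gcongr; nlinarith
      _ = (4 * C' * ((n : ℝ) ^ 2 * (r / ρ) ^ n)) * ρ ^ n := by
          rw [div_pow]; field_simp
      _ ≤ 1 * ρ ^ n := by gcongr
      _ = ρ ^ n := one_mul _
  -- small `n`
  set θ' := max θ (1 / 2) with hθ'
  have hθ'0 : 0 < θ' := lt_of_lt_of_le one_half_pos (le_max_right _ _)
  have hθ'1 : θ' < 1 := max_lt hθ one_half_lt_one
  have hlogθ : Real.log θ' < 0 := Real.log_neg hθ'0 hθ'1
  have hlogρ : Real.log ρ < 0 := Real.log_neg hρ0 hρ1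
  have hNpos : (0 : ℝ) < N + 1 := by positivity
  refine ⟨min (-Real.log θ' / (N + 1)) (-Real.log ρ), lt_min (div_pos (by linarith) hNpos) (by linarith), fun n => ?_⟩
  rcases Nat.eq_zero_or_pos n with rfl | hnpos
  · simp only [Nat.cast_zero, mul_zero, Real.exp_zero]; exact hP1 0
  rcases le_or_gt N n with hNn | hnN
  · refine (hlarge n hNn).trans ?_
    rw [Real.exp_le_exp]
    have : min (-Real.log θ' / (N + 1)) (-Real.log ρ) ≤ -Real.log ρ := min_le_right _ _
    have hn0 : (0 : ℝ) ≤ n := Nat.cast_nonneg n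
    nlinarith
  · have hPn : P n ≤ θ' := (hPθ n hnpos).trans (le_max_left _ _)
    refine hPn.trans ?_
    rw [← Real.log_le_iff_le_exp hθ'0]
    have h1 : min (-Real.log θ' / (N + 1)) (-Real.log ρ) ≤ -Real.log θ' / (N + 1) := min_le_left _ _
    have hnle : (n : ℝ) ≤ N + 1 := by exact_mod_cast (by omega : n ≤ N + 1)
    have hn0 : (0 : ℝ) ≤ n := Nat.cast_nonneg n
    have h2 : -(min (-Real.log θ' / (N + 1)) (-Real.log ρ)) * n ≥ -(-Real.log θ' / (N + 1)) * n := by nlinarith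
    have h3 : -(-Real.log θ' / (N + 1)) * (n : ℝ) = Real.log θ' * (n / (N + 1)) := by field_simp
    have h4 : Real.log θ' * ((n : ℝ) / (N + 1)) ≥ Real.log θ' * 1 := by
      apply mul_le_mul_of_nonpos_left _ hlogθ.le
      rw [div_le_one hNpos]; exact hnle
    linarith

/-- Parity bound: `q^{⌈n/2⌉} ≤ (√q)^n` for `q ∈ [0,1]`. -/
theorem pow_half_le_sqrt_pow {q : ℝ} (hq0 : 0 ≤ q) (hq1 : q ≤ 1) (n : ℕ) : q ^ ((n + 1) / 2) ≤ Real.sqrt q ^ n := by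
  have hsq : Real.sqrt q ^ 2 = q := Real.sq_sqrt hq0
  have hle : q ≤ Real.sqrt q := (Real.le_sqrt hq0 hq0).2 (by nlinarith)
  rcases Nat.even_or_odd' n with ⟨k, rfl | rfl⟩
  · rw [show (2 * k + 1) / 2 = k by omega, pow_mul, hsq]
  · have h1 : q ^ ((2 * k + 1 + 1) / 2) = q ^ k * q := by rw [show (2 * k + 1 + 1) / 2 = k + 1 by omega, pow_succ]
    have h2 : Real.sqrt q ^ (2 * k + 1) = q ^ k * Real.sqrt q := by rw [pow_succ, pow_mul, hsq]
    rw [h1, h2]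
    exact mul_le_mul_of_nonneg_left hle (pow_nonneg hq0 k)

/-- **Exponential fragility of the witness**: for every `q < 1` the thinned one-arm probability decays
exponentially. -/
theorem νsym_frag (q : unitInterval) (hq : (q : ℝ) < 1) :
    ∃ c : ℝ, 0 < c ∧ ∀ n : ℕ, (νsym.prod (bondPercolation (zdGraph 3) q)).real (thinEvent n) ≤ Real.exp (-c * n) := by
  haveI := isProbabilityMeasure_νsym
  have hq0 : 0 ≤ (q : ℝ) := q.2.1
  have hq1 : (q : ℝ) ≤ 1 := q.2.2
  refine exists_exp_decay (fun n => (νsym.prod (bondPercolation (zdGraph 3) q)).real (thinEvent n))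
    (fun n => measureReal_le_one) (θ := 1 - (1 - (q : ℝ)) ^ 6) ?_ (fun n hn => prod_real_thinEvent_le_of_pos q hn)
    (r := Real.sqrt q) (C := 24) (Real.sqrt_nonneg _) ?_ fun n => ?_
  · have : 0 < (1 - (q : ℝ)) ^ 6 := pow_pos (by linarith) 6
    linarith
  · rw [Real.sqrt_lt' one_pos, one_pow]; exact hq
  · refine (prod_real_thinEvent_le q n).trans ?_
    have hn : (0 : ℝ) ≤ n := Nat.cast_nonneg n
    have h1 : (6 : ℝ) * (2 * n + 1) ^ 2 ≤ 24 * (n + 1) ^ 2 := by nlinarith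
    have h2 := pow_half_le_sqrt_pow hq0 hq1 n
    exact mul_le_mul h1 h2 (pow_nonneg hq0 _) (by positivity)

/-- **`FragileWeavingGiantExists` holds** (item stmt-CriticalPhenomena-5266 of route `PercThresholdOne`):
the symmetrised law `νsym` of the stationary hierarchical spanning tree of `ℤ³` is a probability measure
on nearest-neighbour bond configurations, invariant under translations, coordinate permutations and the
reflection of the first coordinate, almost surely a connected (hence uniquely percolating and dense)
weaving tree, and exponentially subcritical under every independent thinning. (The route card suggested
the uniform spanning tree; this elementary witness needs no UST theory.) -/
theorem fragileWeavingGiantExists_proof :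
    Summit.CriticalPhenomena.PercolationContinuityZ3.Theses.PercThresholdOne.FragileWeavingGiantExists := by
  refine ⟨νsym, isProbabilityMeasure_νsym, fun g hg A hA => νsym_invariant g hg A hA, ?_, νsym_real_percolates_pos,
    fun q hq => νsym_frag q hq⟩
  filter_upwards [ae_goodConfigs] with ξ hξ
  exact hξ

end Summit.CriticalPhenomena.PercolationContinuityZ3.Theorems.FragileGiant
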